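import Summits.AtomisticToContinuum.HydrodynamicLimit.Theorems.InfluenceLocality.Negative.PhaseTrackingPrelim
import HarnessLib

/-!
# Phase tracking along a valid phase script (stub `stub_phaseTracking`, line `ignition-cascade-refutation`,
# crux `InfluenceLocality`, stmt-AtomisticToContinuum-13916)

The design-independent core of the `ignition` field of `IsIgnitionTemplate`: a hard-sphere trajectory of `𝕋³` whose
time-`0` states lie in phase `0` of a track-valid phase script follows the script (the tracking invariant `trackSet`
of Negative/PhaseTrackingPrelim.lean holds on `[0, T]`), hence kicks every particle `i` with `deadline i 0 ≤ T` before
that deadline.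

* `mem_trackSet_of_forall_lt` — left closure of the invariant: up to the next critical time the motion is the free
  flight from a collision-free window (`inv`), deadlines are not reached (`lt_deadline_of_window`), and at a
  collision the incoming left limit and `sep` make the pair in contact a designed one, oriented from the particle
  whose event it is; `post` puts the reflected states (`collidePair`) in the next phases; the ghost indices of the
  pair increase by one and mutuality of the design preserves the schedule bookkeeping;
* `mem_trackSet_of_mem_Icc` — the invariant on `[0, T]` (real induction on the first bad time, with
  `zero_mem_trackSet` and the right extension `exists_Ico_subset_trackSet`);
* `phaseTracking` / `stub_phaseTracking` — the registered conclusion: the ghost index of `i` at `deadline i 0` is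
  positive, so `i` has a first collision time `t_c ∈ (0, deadline i 0]`, before which its velocity is the initial
  one and at which it jumps (incoming left limit, nonzero impact vector).

References: Gallagher–Saint-Raymond–Texier 2013 §4.1; Cercignani–Illner–Pulvirenti 1994 §4.2.
-/

namespace Summit.AtomisticToContinuum.HydrodynamicLimit.Theorems.InfluenceLocality.Negative

open MeasureTheory Set Filter Topology
open scoped InnerProductSpace
open Literature.Analysis.FluidPDE Literature.MathematicalPhysics.KineticTheory
open Literature.Analysis.FunctionSpaces
open Summit.AtomisticToContinuum.HydrodynamicLimit.Theorems.EnskogCompensator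
  (apply_eq_freeFlight_of_forall_not_participates vel_eq_of_forall_not_participates)

noncomputable section

variable {n : ℕ} {ε T : ℝ} {γ : ℝ → Config n (Fin 3) T3} {S : PhaseScript n}

/-- **Left closure.** If the invariant holds on `[0, t')` with `0 < t' ≤ T`, it holds at `t'`: up to `t'` the motion
is the free flight from a time `y` of a collision-free window (`inv`), deadlines are not reached
(`lt_deadline_of_window`); if `t'` is a collision time, the pair in contact is designed (`sep`), oriented from the
particle whose event it is, the left limit is incoming and `post` puts the reflected states in the next phases, the
ghost indices of the pair increase by one and the schedule bookkeeping is preserved by mutuality of the design. -/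
theorem mem_trackSet_of_forall_lt (hγ : IsHardSphereTrajectory (Torus.geometry (Fin 3)) ε n γ) (hS : S.TrackValid ε T)
    {t' : ℝ} (h0t : 0 < t') (ht'T : t' ≤ T) (h : ∀ t ∈ Ico 0 t', t ∈ trackSet S ε γ) :
    t' ∈ trackSet S ε γ := by
  have hGc : ∀ x, Continuous ((Torus.geometry (Fin 3)).translate x) := Torus.continuous_geometry_translate
  obtain ⟨y, hy0, hyt, hfree, hy, hidx, hdl⟩ := exists_free_window hγ h0t h
  have hlt : ∀ i, t' < S.deadline i (phaseIdx ε γ i y) :=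
    lt_deadline_of_window hγ hS h0t ht'T h hy0 hyt hidx hdl
  obtain ⟨hmem, hK, -, hexp⟩ := hy
  -- the left limit at `t'`
  set zl : Config n (Fin 3) T3 := freeFlight (Torus.geometry (Fin 3)) (t' - y) (γ y) with hzl_def
  have hzl : Tendsto γ (𝓝[<] t') (𝓝 zl) := hγ.tendsto_nhdsLT hGc hyt hfree
  have hmem' : ∀ i, (t', (zl i).1, (zl i).2) ∈ S.phase i (phaseIdx ε γ i y) := fun i => by
    have := hS.inv i _ y (γ y i).1 (γ y i).2 (t' - y) (hmem i) (sub_nonneg.2 hyt.le)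
    rwa [add_sub_cancel] at this
  have hpos : ∀ i, (γ t' i).1 = (zl i).1 := fun i => hγ.apply_fst_eq_freeFlight_of_Ioo_free hGc hyt hfree i
  have hnp : ∀ i, ∀ s ∈ Ioo y t', ¬ Participates (Torus.geometry (Fin 3)) ε (γ s) i := fun i s hs hp =>
    hfree s hs (collisionTimesOf_subset γ i hp)
  by_cases hcol : t' ∈ collisionTimes (Torus.geometry (Fin 3)) ε γ
  swap
  · -- no collision at `t'`
    have hγt : γ t' = zl := hγ.free y t' hyt.le fun τ hτ => by
      rcases hτ.2.eq_or_lt with rfl | hlt'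
      · exact hcol
      · exact hfree τ ⟨hτ.1, hlt'⟩
    have hidx' : ∀ i, phaseIdx ε γ i t' = phaseIdx ε γ i y := fun i =>
      phaseIdx_eq_of_forall_not_participates hyt.le fun s hs hp => by
        rcases hs.2.eq_or_lt with rfl | hlt'
        · exact hcol (collisionTimesOf_subset γ i hp)
        · exact hnp i s ⟨hs.1, hlt'⟩ hp
    refine ⟨fun i => ?_, fun i => ?_, fun i => ?_, fun i m hm hmK => ?_⟩
    · rw [hidx' i, hγt]; exact hmem' i
    · rw [hidx' i]; exact hK i
    · rw [hidx' i]; exact hlt i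
    · rw [hidx'] at hm ⊢; exact hexp i m hm hmK
  · -- a collision at `t'`: a designed pair `(p, q)`, oriented from `p`
    obtain ⟨p, q, hpq, hc, hkp, hpartner, hpphase⟩ : ∃ p q : Fin n, p ≠ q ∧
        γ t' ∈ contactSet (Torus.geometry (Fin 3)) n ε p q ∧ phaseIdx ε γ p y < S.K p ∧
        S.partner p (phaseIdx ε γ p y) = q ∧ S.pphase p (phaseIdx ε γ p y) = phaseIdx ε γ q y := by
      obtain ⟨a, b, hab, hc⟩ := hcol
      have hnorm : ‖(Torus.geometry (Fin 3)).sepVec (zl a).1 (zl b).1‖ = ε := by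
        rw [← hpos a, ← hpos b]; exact (mem_contactSet.1 hc).2
      -- the left limit is incoming for `(a, b)`
      have hin₀ : ⟪(Torus.geometry (Fin 3)).sepVec (zl a).1 (zl b).1, (zl a).2 - (zl b).2⟫_ℝ < 0 := by
        obtain ⟨-, zl₀, hzl₀, hin₀, -⟩ := hγ.binary t' a b hab hc
        have hzz₀ : zl₀ = zl := tendsto_nhds_unique hzl₀ hzl
        rw [hzz₀] at hin₀
        exact hin₀
      -- the two current (particle, phase) pairs are schedule consistent (invariant at `y`)
      have hcons : S.Consistent a (phaseIdx ε γ a y) b (phaseIdx ε γ b y) := by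
        refine ⟨fun m hm hmK hpm => ?_, fun m hm hmK hpm => ?_⟩
        · have := hexp a m hm hmK
          rwa [hpm] at this
        · have := hexp b m hm hmK
          rwa [hpm] at this
      have hdes : S.Designed a (phaseIdx ε γ a y) b (phaseIdx ε γ b y) := by
        by_contra hnd
        have := hS.sep a b _ _ t' (zl a).1 (zl a).2 (zl b).1 (zl b).2 hab hnd hcons (hmem' a) (hmem' b)
          (hdl a) (hdl b) h0t.le ht'T hnorm
        exact (not_lt.2 this) hin₀
      rcases hdes with ⟨h1, h2, h3⟩ | ⟨h1, h2, h3⟩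
      · exact ⟨a, b, hab, hc, h1, h2, h3⟩
      · exact ⟨b, a, hab.symm, torus_contactSet_comm.1 hc, h1, h2, h3⟩
    obtain ⟨-, zl', hzl', hin, heq⟩ := hγ.binary t' p q hpq hc
    have hzz : zl' = zl := tendsto_nhds_unique hzl' hzl
    subst hzz
    have hnorm : ‖(Torus.geometry (Fin 3)).sepVec (zl p).1 (zl q).1‖ = ε := by
      rw [← hpos p, ← hpos q]; exact (mem_contactSet.1 hc).2
    have hmq : (t', (zl q).1, (zl q).2) ∈ S.phase (S.partner p (phaseIdx ε γ p y)) (S.pphase p (phaseIdx ε γ p y)) := by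
      rw [hpartner, hpphase]; exact hmem' q
    obtain ⟨hpost_p, hpost_q⟩ := hS.post p _ t' (zl p).1 (zl p).2 (zl q).1 (zl q).2 hkp (hmem' p) hmq
      (hdl p) h0t.le ht'T hnorm hin
    rw [hpartner, hpphase] at hpost_q
    -- participation at `t'` and the new ghost indices
    have hpc : (p, q) ∈ contactPairs (Torus.geometry (Fin 3)) ε (γ t') := mem_contactPairs.2 ⟨hpq, hc⟩
    have hP : phaseIdx ε γ p t' = phaseIdx ε γ p y + 1 := phaseIdx_succ hγ hy0 hyt (hnp p) ⟨q, Or.inl hpc⟩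
    have hQ : phaseIdx ε γ q t' = phaseIdx ε γ q y + 1 := phaseIdx_succ hγ hy0 hyt (hnp q) ⟨p, Or.inr hpc⟩
    have hO : ∀ j, j ≠ p → j ≠ q → phaseIdx ε γ j t' = phaseIdx ε γ j y := fun j hjp hjq =>
      phaseIdx_eq_of_forall_not_participates hyt.le fun s hs hpj => by
        rcases hs.2.eq_or_lt with rfl | hlt'
        · rcases (hγ.participates_iff hpc).1 hpj with h' | h'
          · exact hjp h'
          · exact hjq h'
        · exact hnp j s ⟨hs.1, hlt'⟩ hpj
    have hOst : ∀ j, j ≠ p → j ≠ q → γ t' j = zl j := fun j hjp hjq => by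
      rw [heq, collidePair_apply_of_ne hjp hjq]
    -- mutual data of the event
    obtain ⟨-, -, hqp, hqk, hKq⟩ := hS.partnerMutual p _ hkp
    rw [hpartner, hpphase] at hqp hqk hKq
    refine ⟨fun i => ?_, fun i => ?_, fun i => ?_, fun i m hm hmK => ?_⟩
    · -- phases
      by_cases hip : i = p
      · subst hip
        rw [hP, heq, collidePair_apply_left hpq]; exact hpost_p
      by_cases hiq : i = q
      · subst hiq
        rw [hQ, heq, collidePair_apply_right]; exact hpost_q
      rw [hO i hip hiq, hOst i hip hiq]; exact hmem' i
    · -- index bounds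
      by_cases hip : i = p
      · subst hip; rw [hP]; exact hkp
      by_cases hiq : i = q
      · subst hiq; rw [hQ]; exact hKq
      rw [hO i hip hiq]; exact hK i
    · -- deadlines
      by_cases hip : i = p
      · subst hip; rw [hP]; exact (hlt _).trans_le (hS.deadlineMono _ _)
      by_cases hiq : i = q
      · subst hiq; rw [hQ]; exact (hlt _).trans_le (hS.deadlineMono _ _)
      rw [hO i hip hiq]; exact hlt i
    · -- schedule bookkeeping
      have hmy : phaseIdx ε γ i y ≤ m := (phaseIdx_mono hγ i hyt.le).trans hm
      have hj := hexp i m hmy hmK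
      by_cases hjp : S.partner i m = p
      · rw [hjp] at hj ⊢
        rw [hP]
        refine Nat.succ_le_of_lt (hj.lt_of_ne fun hkeq => ?_)
        obtain ⟨-, -, hqi, hmq', -⟩ := hS.partnerMutual i m hmK
        rw [hjp, ← hkeq, hpartner] at hqi
        rw [hjp, ← hkeq, hpphase] at hmq'
        subst hqi
        rw [hQ] at hm
        omega
      by_cases hjq : S.partner i m = q
      · rw [hjq] at hj ⊢
        rw [hQ]
        refine Nat.succ_le_of_lt (hj.lt_of_ne fun hkeq => ?_)
        obtain ⟨-, -, hpi, hmp', -⟩ := hS.partnerMutual i m hmK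
        rw [hjq, ← hkeq, hqp] at hpi
        rw [hjq, ← hkeq, hqk] at hmp'
        subst hpi
        rw [hP] at hm
        omega
      rw [hO _ hjp hjq]; exact hj

/-! ## The invariant on `[0, T]` and the registered statement -/

/-- **Robust tracking.** The tracking invariant holds at every time of `[0, T]`
(real induction: the first bad time would satisfy the invariant by `zero_mem_trackSet` /
`mem_trackSet_of_forall_lt`, and then so would a right neighbourhood, `exists_Ico_subset_trackSet`). -/
theorem mem_trackSet_of_mem_Icc (hγ : IsHardSphereTrajectory (Torus.geometry (Fin 3)) ε n γ) (hS : S.TrackValid ε T)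
    (h0 : ∀ i, ((0 : ℝ), (γ 0 i).1, (γ 0 i).2) ∈ S.phase i 0) {t : ℝ} (ht : t ∈ Icc 0 T) :
    t ∈ trackSet S ε γ := by
  by_contra hnot
  set B : Set ℝ := {t | t ∈ Icc 0 T ∧ t ∉ trackSet S ε γ} with hB
  have htB : t ∈ B := ⟨ht, hnot⟩
  have hne : B.Nonempty := ⟨t, htB⟩
  have hbdd : BddBelow B := ⟨0, fun b hb => hb.1.1⟩
  have hle : ∀ b ∈ B, sInf B ≤ b := fun b hb => csInf_le hbdd hb
  have h0' : 0 ≤ sInf B := le_csInf hne fun b hb => hb.1.1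
  have hT : sInf B ≤ T := (hle t htB).trans ht.2
  have hbefore : ∀ b ∈ Ico 0 (sInf B), b ∈ trackSet S ε γ := fun b hb => by
    by_contra hb'
    exact (not_le.2 hb.2) (hle b ⟨⟨hb.1, hb.2.le.trans hT⟩, hb'⟩)
  have hat : sInf B ∈ trackSet S ε γ := by
    rcases h0'.eq_or_lt with h00 | hpos
    · rw [← h00]; exact zero_mem_trackSet hS h0
    · exact mem_trackSet_of_forall_lt hγ hS hpos hT hbefore
  obtain ⟨δ, hδ, hext⟩ := exists_Ico_subset_trackSet hγ hS hat
  have hlow : ∀ b ∈ B, sInf B + δ ≤ b := fun b hb => by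
    by_contra hlt
    exact hb.2 (hext b ⟨hle b hb, not_le.1 hlt⟩)
  have := le_csInf hne hlow
  linarith

/-- On the torus, colliding particles are in contact in the given order (contact is symmetric). -/
theorem torus_mem_contactSet_of_collide' {z : Config n (Fin 3) T3} {i j : Fin n}
    (h : Collide (Torus.geometry (Fin 3)) ε z i j) : z ∈ contactSet (Torus.geometry (Fin 3)) n ε i j := by
  rcases h with h | h
  · exact (mem_contactPairs.1 h).2
  · exact torus_contactSet_comm.1 (mem_contactPairs.1 h).2

/-- **Phase tracking (registered conclusion over the corrected validity `PhaseScript.TrackValid`).** A hard-sphere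
trajectory of `𝕋³` whose time-`0` states are in phase `0` of a track-valid phase script kicks every particle `i` with
`deadline i 0 ≤ T` at some time of `[0, deadline i 0]`: by `mem_trackSet_of_mem_Icc` the ghost index of `i` at
`deadline i 0` is positive, so `i` has a first collision time `t_c ∈ (0, deadline i 0]`; its velocity is the initial one
on `[0, t_c)` and jumps at `t_c` (the left limit is incoming, so the reflected velocity differs). -/
theorem phaseTracking (hε : 0 < ε) (S : PhaseScript n) (hS : S.TrackValid ε T)
    (hγ : IsHardSphereTrajectory (Torus.geometry (Fin 3)) ε n γ)
    (h0 : ∀ i, ((0 : ℝ), (γ 0 i).1, (γ 0 i).2) ∈ S.phase i 0) :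
    ∀ i, S.deadline i 0 ≤ T → ∃ t ∈ Set.Icc (0 : ℝ) (S.deadline i 0), (γ t i).2 ≠ (γ 0 i).2 := by
  intro i hdT
  have hGc : ∀ x, Continuous ((Torus.geometry (Fin 3)).translate x) := Torus.continuous_geometry_translate
  have hd0 : 0 < S.deadline i 0 := hS.deadlinePos i
  have hinv := mem_trackSet_of_mem_Icc hγ hS h0 (t := S.deadline i 0) ⟨hd0.le, hdT⟩
  have hne0 : phaseIdx ε γ i (S.deadline i 0) ≠ 0 := fun h => by
    have := hinv.2.2.1 i
    rw [h] at this
    exact lt_irrefl _ this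
  obtain ⟨τ, hτ, hτp⟩ := exists_participates_of_phaseIdx_ne_zero hne0
  -- the first collision time of `i`
  have hne : (collisionTimesOf (Torus.geometry (Fin 3)) ε γ i ∩ Ioi 0).Nonempty := ⟨τ, hτp, hτ.1⟩
  have hleast := hγ.isLeast_nthCollisionTimeOf_zero hne
  have htc0 : 0 < nthCollisionTimeOf (Torus.geometry (Fin 3)) ε γ 0 i 0 := hleast.1.2
  have htcτ : nthCollisionTimeOf (Torus.geometry (Fin 3)) ε γ 0 i 0 ≤ τ := hleast.2 ⟨hτp, hτ.1⟩
  have hfree_i : ∀ s ∈ Ioo 0 (nthCollisionTimeOf (Torus.geometry (Fin 3)) ε γ 0 i 0),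
      ¬ Participates (Torus.geometry (Fin 3)) ε (γ s) i := fun s hs hp =>
    (not_lt.2 (hleast.2 ⟨hp, hs.1⟩)) hs.2
  refine ⟨_, ⟨htc0.le, htcτ.trans hτ.2⟩, fun hv => ?_⟩
  obtain ⟨j, hcij⟩ := hleast.1.1
  have hij : i ≠ j := hcij.ne
  have hc := torus_mem_contactSet_of_collide' hcij
  obtain ⟨-, zl, hzl, hin, heq⟩ := hγ.binary _ i j hij hc
  -- the velocity of `i` just before its first collision is the initial one
  have hvl : (zl i).2 = (γ 0 i).2 := by
    have hev : Continuous fun z : Config n (Fin 3) T3 => (z i).2 := by fun_prop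
    have h1 : Tendsto (fun s => (γ s i).2) (𝓝[<] (nthCollisionTimeOf (Torus.geometry (Fin 3)) ε γ 0 i 0))
        (𝓝 (zl i).2) := (hev.tendsto zl).comp hzl
    have h2 : Tendsto (fun s => (γ s i).2) (𝓝[<] (nthCollisionTimeOf (Torus.geometry (Fin 3)) ε γ 0 i 0))
        (𝓝 (γ 0 i).2) := by
      refine tendsto_const_nhds.congr' ?_
      filter_upwards [Ioo_mem_nhdsLT htc0] with s hs
      exact (vel_eq_of_forall_not_participates hγ hGc hs.1.le fun σ hσ =>
        hfree_i σ ⟨hσ.1, hσ.2.trans_lt hs.2⟩).symm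
    exact tendsto_nhds_unique h1 h2
  -- the jump is nonzero because the left limit is incoming
  have hn0 : (Torus.geometry (Fin 3)).sepVec (zl i).1 (zl j).1 ≠ 0 := by
    intro hz
    have := (mem_contactSet.1 hc).2
    rw [heq, collidePair_apply_fst, collidePair_apply_fst, hz, norm_zero] at this
    exact hε.ne' this.symm
  have hcoef : ⟪(zl i).2 - (zl j).2, (Torus.geometry (Fin 3)).sepVec (zl i).1 (zl j).1⟫_ℝ /
      ‖(Torus.geometry (Fin 3)).sepVec (zl i).1 (zl j).1‖ ^ 2 ≠ 0 := by
    refine div_ne_zero ?_ (pow_ne_zero 2 (norm_ne_zero_iff.2 hn0))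
    rw [real_inner_comm]
    exact ne_of_lt hin
  have hvi : (γ (nthCollisionTimeOf (Torus.geometry (Fin 3)) ε γ 0 i 0) i).2 = (zl i).2 -
      (⟪(zl i).2 - (zl j).2, (Torus.geometry (Fin 3)).sepVec (zl i).1 (zl j).1⟫_ℝ /
        ‖(Torus.geometry (Fin 3)).sepVec (zl i).1 (zl j).1‖ ^ 2) • (Torus.geometry (Fin 3)).sepVec (zl i).1 (zl j).1 := by
    rw [heq, collidePair_apply_left hij]
    rfl
  rw [hvi, ← hvl, sub_eq_self] at hv
  rcases smul_eq_zero.1 hv with h | h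
  · exact hcoef h
  · exact hn0 h

/-- The REGISTERED stub of the line skeleton (`Cruxes/InfluenceLocality/Lines/ignition_cascade_refutation.lean`,
reshaped 2026-08-17 to the corrected validity predicate `PhaseScript.TrackValid`): phase tracking kicks every particle
before the deadline of its phase `0`. -/
theorem stub_phaseTracking {n : ℕ} {ε T : ℝ} (hε : 0 < ε) (S : PhaseScript n) (hS : S.TrackValid ε T)
    {γ : ℝ → Config n (Fin 3) T3} (hγ : IsHardSphereTrajectory (Torus.geometry (Fin 3)) ε n γ)
    (h0 : ∀ i, ((0 : ℝ), (γ 0 i).1, (γ 0 i).2) ∈ S.phase i 0) :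
    ∀ i, S.deadline i 0 ≤ T → ∃ t ∈ Set.Icc (0 : ℝ) (S.deadline i 0), (γ t i).2 ≠ (γ 0 i).2 :=
  phaseTracking hε S hS hγ h0

end

end Summit.AtomisticToContinuum.HydrodynamicLimit.Theorems.InfluenceLocality.Negative
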